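import Summits.QuantumFields.YangMills.Theorems.UnitScaleTiltProp7CovariantPlaquetteExpansion
import Literature.MathematicalPhysics.QuantumFieldTheory.Balaban1983to89.T3SectALandauChart
import Literature.MathematicalPhysics.QuantumFieldTheory.Balaban1983to89.B15Ineq146Proof
import HarnessLib

/-!
# Route `UnitScaleTilt`, crux K1 child «MinimiserStabilityRegPr» (stmt-QuantumFields-19200), registered stub `stub_prop7From14` (skeleton birth_v7
# cc37a178…; leaf V3) — pillar P-V3-CDE, native row (D) «the p. 299 return to (18)»: ITS PLAQUETTE CLAUSE IS A THEOREM AT THE T³ CARRIER —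
# a configuration `U₁ = e^{iX}` in [Balaban1985Variational] (19) at radius `ε₂ ≤ ¼` over a background `U₀` with plaquettes within `a·η²` gives
# `U₁U₀` plaquettes within `(2a + 11ε₂)·η²` ([Balaban1985RegularSpaces] (1.47): `(∂_{U₀}U₁)(p) − 1 = iη(D^η_{U₀}ηA)(p) + O((η·∂|A|(p))²)`)

Cell `ym3-torus`, width seat `ym-ust-19200-w2` (gen 0; D-0149; OWNER W-SEAT START LIST 2026-08-27 22:29Z «w2 = P-V3-CDE»).  YM₃ on T³ is a ladder rung (R3),
not the Clay problem; nothing here is a claim about the crux, d = 4 or the mass gap.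

WHY.  At the log-chart letters of the v8 presentation (`Prop7TPrint`, this seat) the pillar P-V3-CDE reduces to three native statements
(`Prop7PV3CDELogChart.prop7From14At_of_natives_logChart`); row (D) is print's p. 299 *«Proposition 7 [6] implies that U_k belongs to the space (18) with
ε₀ = O(1)C₁B₃ε₁»* — with seat w1's `CritL` (the chart image of an R2-critical configuration) and the gauge invariance of print's regular space
(`T3PrintedRegularOrbits.regPr_gaugeAct_iff`) its content is the GAUGE-INVARIANT ESTIMATE «`U₁` in (19) at `ε₂` over `U₀ ∈ 𝔘_k(a)` ⇒ `U₁U₀ ∈ 𝔘_k(O(1)(a + ε₂))`»,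
whose two clauses are the plaquette clause ([Balaban1985RegularSpaces] (1.47) p. 84) and the covariant-divergence clause (the second-order members of (19)).
THIS FILE proves the PLAQUETTE CLAUSE at the T³ carrier, for every `SU(2)` background, k-uniformly, absolute constants.

THE PRINT.  [Balaban1985RegularSpaces] p. 84: *«(∂_{U₀}U₁)(p) = exp iη(D^η_{U₀}ηA)(p) + …, where a remainder is O₁((1/2!)η²(∂|A|(p))²)» (1.47)*; [Balaban1985Variational]
(19) p. 281: *«U₁ = e^{iηA}, |A| < ε₂(Lʲη)⁻¹, |∇^η_{U₀}A| < ε₂(Lʲη)⁻²»*; (2) p. 278: *«|U(∂p) − 1| < ε₀η²(Lʲη)⁻²»*.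

WHAT IS PROVED (sorry-free, no definition; `SU(2)` read in `M₂(ℂ)`, operator norm; `η = L^{−(K−n)}`).
§1 `norm_exp_I_smul_sub_one_sub_le_sq` (`‖e^{iY} − 1 − iY‖ ≤ ½‖Y‖²`, Hermitian `Y`, from `B15Ineq146Proof.norm_exp_sub_one_sub_le_of_skew`),
   `coe_emb15_mul_star` (the fluctuation of `U₁U₀` relative to `U₀` is `U₁`), `covGradT_one_bgUnits_eq` (the (19) gradient letter in matrices), `eta_le_one`
   (`dist1` on `SU(2)` is `‖· − 1‖_op` by `rfl`, cf. `SU2Mean.dist1_eq_norm`).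
§2 **`dist1_plaqHol_emb15_lt`**: `In19 F n K ε₂ U₀ U₁ X`, `ε₂ ≤ ¼`, `|U₀(∂p) − 1| < a·η²` ⟹ `|(U₁U₀)(∂p) − 1| < (2a + 11ε₂)·η²` — via the seat p1 lineage's covariant
   second-order expansion `Prop7CovariantCoercivity.norm_plaqHol_mul_star_bg_sub_one_sub_covCurl_le` (linear part = the covariant curl = the difference of two
   (19)-gradient entries `< 2ε₂η²`; `e^{iX} − 1 − iX` and the quadratic remainder `≤ 34ε₂²η²`; curvature × fluctuation `≤ 4aε₂η³`).
§3 **`plaqSmall_emb15_of_in19`**: `PlaqSmall (regThreshold F n K a) U₀ → In19 F n K ε₂ U₀ U₁ X → ε₂ ≤ ¼ → PlaqSmall (regThreshold F n K (2a + 11ε₂)) (emb15 U₀ U₁)` —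
   the plaquette half of row (D)'s estimate (in print's regime `a = C₁B₃ε₁ ≤ ε₂`: radius `13ε₂`), and `plaqSmall_gaugeAct_emb15_of_in19` (the same for `(U₁U₀)^u`).

HONEST SCOPE.  The divergence clause of (2) for `U₁U₀` (needs the two second-order members of (19) and the codifferential calculus at a curved background) is
NOT here; nor is the criticality half of row (D) (which is seat w1's `CritL` letter unfolded).  Count-neutral helper toward stmt-QuantumFields-19200
(`--supports`), not a proof of the stub.

References: T. Bałaban, CMP 99 (1985) 75–102 [Balaban1985RegularSpaces] ((1.47) p.84, (1.36) p.82, Prop. 7 p.98); CMP 102 (1985) 277–309 [Balaban1985Variational]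
((2) p.278, (19) p.281, p.299); CMP 99 (1985) 389–434 [Balaban1985BackgroundPropagators] ((3.1)–(3.4) pp.390–391).
-/

noncomputable section

namespace Summit.QuantumFields.YangMills.Theorems.Prop7B8Prop7Plaq

open Literature.MathematicalPhysics.QuantumFieldTheory.Balaban1983to89
open Literature.MathematicalPhysics.QuantumFieldTheory.Balaban1983to89.T3ContinuumYM3Torus
open Literature.MathematicalPhysics.QuantumFieldTheory.Balaban1983to89.T3RegularMinimiser (regThreshold)
open Literature.MathematicalPhysics.QuantumFieldTheory.Balaban1983to89.T3LowerAlongMinimisersSplit (L_cast_pos)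
open B10Eq27TorusAxialLog (toUField unitsField unitsField_mem_unitaryUnits val_unitsField)
open B7Eq78Linearization (conjR conjR_apply)
open T3Thm1Carrier
open T3SectALandauChart
open Summit.QuantumFields.YangMills.Theorems.Prop7CovariantCoercivity (norm_plaqHol_mul_star_bg_sub_one_sub_covCurl_le coe_inv_eq_star)
open NormedSpace

open scoped Matrix.Norms.L2Operator

/-! ## §1 Matrix and letter bookkeeping -/

section Bookkeeping

/-- **(1.47)'s one-factor remainder**: `‖e^{iY} − 1 − iY‖ ≤ ½‖Y‖²` for Hermitian `Y ∈ M₂(ℂ)` (`iY` is skew-adjoint; `B15Ineq146Proof.norm_exp_sub_one_sub_le_of_skew`).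
[cite: Balaban1985RegularSpaces, p.84 («a remainder is O₁((1/2!)η²(∂|A|(p))²)»)] -/
theorem norm_exp_I_smul_sub_one_sub_le_sq {Y : Matrix (Fin 2) (Fin 2) ℂ} (hY : Y.IsHermitian) :
    ‖exp (Complex.I • Y) - 1 - Complex.I • Y‖ ≤ ‖Y‖ ^ 2 / 2 := by
  letI : CStarAlgebra (Matrix (Fin 2) (Fin 2) ℂ) := B10Eq29TubeLine.cstarAlgebraMatrix 2
  have hsk : Complex.I • Y ∈ skewAdjoint (Matrix (Fin 2) (Fin 2) ℂ) := by
    rw [skewAdjoint.mem_iff, star_smul, Complex.star_def, Complex.conj_I, Matrix.star_eq_conjTranspose, hY.eq, neg_smul]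
  have h := B15Ineq146Proof.norm_exp_sub_one_sub_le_of_skew hsk
  rwa [norm_smul, Complex.norm_I, one_mul] at h

/-- **(24) of [Balaban1985Averaging]**: `‖e^{iY} − 1‖ ≤ ‖Y‖` for Hermitian `Y`. [cite: Balaban1985Averaging, (24) p.21] -/
theorem norm_exp_I_smul_sub_one_le' {Y : Matrix (Fin 2) (Fin 2) ℂ} (hY : Y.IsHermitian) : ‖exp (Complex.I • Y) - 1‖ ≤ ‖Y‖ := by
  letI : CStarAlgebra (Matrix (Fin 2) (Fin 2) ℂ) := B10Eq29TubeLine.cstarAlgebraMatrix 2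
  exact B8Ineq170.norm_exp_I_smul_sub_one_le hY.isSelfAdjoint

variable {F : T3Family} {n K : ℕ}

/-- **THE FLUCTUATION OF `U₁U₀` RELATIVE TO `U₀` IS `U₁`**: `(U₁U₀)(b)·U₀(b)^* = U₁(b)` in `M₂(ℂ)`. [cite: Balaban1985Variational, (15) p.280] -/
theorem coe_emb15_mul_star (U₀ U₁ : GaugeField (F.P K) 0 (Matrix.specialUnitaryGroup (Fin 2) ℂ)) (b : PBond (F.P K) 0) :
    ((emb15 U₀ U₁ b : Matrix.specialUnitaryGroup (Fin 2) ℂ) : Matrix (Fin 2) (Fin 2) ℂ) * star ((U₀ b : Matrix.specialUnitaryGroup (Fin 2) ℂ) : Matrix (Fin 2) (Fin 2) ℂ)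
      = ((U₁ b : Matrix.specialUnitaryGroup (Fin 2) ℂ) : Matrix (Fin 2) (Fin 2) ℂ) := by
  have h0 : ((U₀ b : Matrix.specialUnitaryGroup (Fin 2) ℂ) : Matrix (Fin 2) (Fin 2) ℂ) * star ((U₀ b : Matrix.specialUnitaryGroup (Fin 2) ℂ) : Matrix (Fin 2) (Fin 2) ℂ) = 1 :=
    Matrix.mem_unitaryGroup_iff.mp (U₀ b).2.1
  show ((U₁ b * U₀ b : Matrix.specialUnitaryGroup (Fin 2) ℂ) : Matrix (Fin 2) (Fin 2) ℂ) * _ = _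
  rw [Submonoid.coe_mul, mul_assoc, h0, mul_one]

/-- **THE (19) GRADIENT LETTER IN MATRICES**: `(∇¹_{U₀}X)_{μν}(x) = U₀(x,μ)·X(x+e_μ,ν)·U₀(x,μ)^* − X(x,ν)` ([Balaban1985RegularSpaces] (1.1) with `R(U)X = UXU⁻¹`,
`U⁻¹ = U^*`). [cite: Balaban1985RegularSpaces, (1.1) p.76] -/
theorem covGradT_one_bgUnits_eq (U₀ : GaugeField (F.P K) 0 (Matrix.specialUnitaryGroup (Fin 2) ℂ)) (X : PBond (F.P K) 0 → Matrix (Fin 2) (Fin 2) ℂ)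
    (μ ν : Fin (F.P K).d) (x : Site (F.P K) 0) :
    covGradT 1 (bgUnits F K U₀) X μ ν x
      = ((U₀ ⟨x, μ⟩ : Matrix.specialUnitaryGroup (Fin 2) ℂ) : Matrix (Fin 2) (Fin 2) ℂ) * X ⟨x.shift μ, ν⟩
          * star ((U₀ ⟨x, μ⟩ : Matrix.specialUnitaryGroup (Fin 2) ℂ) : Matrix (Fin 2) (Fin 2) ℂ) - X ⟨x, ν⟩ := by
  have hu : ((bgUnits F K U₀ ⟨x, μ⟩ : (Matrix (Fin 2) (Fin 2) ℂ)ˣ) : Matrix (Fin 2) (Fin 2) ℂ)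
      = ((U₀ ⟨x, μ⟩ : Matrix.specialUnitaryGroup (Fin 2) ℂ) : Matrix (Fin 2) (Fin 2) ℂ) := rfl
  have hui : (((bgUnits F K U₀ ⟨x, μ⟩)⁻¹ : (Matrix (Fin 2) (Fin 2) ℂ)ˣ) : Matrix (Fin 2) (Fin 2) ℂ)
      = star ((U₀ ⟨x, μ⟩ : Matrix.specialUnitaryGroup (Fin 2) ℂ) : Matrix (Fin 2) (Fin 2) ℂ) := by
    show (((unitsField (toUField U₀) ⟨x, μ⟩)⁻¹ : (Matrix (Fin 2) (Fin 2) ℂ)ˣ) : Matrix (Fin 2) (Fin 2) ℂ) = _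
    rw [coe_inv_eq_star (B7Prop2Explicit.mem_unitaryUnits.mp (unitsField_mem_unitaryUnits (toUField U₀) ⟨x, μ⟩))]
    rfl
  simp only [covGradT, covDerivFwdT, formComp, inv_one, one_smul, conjR_apply, hu, hui]

/-- `η = L^{−(K−n)} ≤ 1`. [cite: Balaban1985Variational, (2) p.278] -/
theorem eta_le_one (F : T3Family) (n K : ℕ) : eta F n K ≤ 1 := by
  have hL : (1 : ℝ) ≤ (F.L : ℝ) := by exact_mod_cast F.hL.2.le
  exact pow_le_one₀ (inv_nonneg.mpr (L_cast_pos F).le) (inv_le_one_of_one_le₀ hL)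

end Bookkeeping

/-! ## §2 The plaquette of `U₁U₀` from (19) and the background's plaquette -/

section Plaquette

variable (F : T3Family) (n K : ℕ)
set_option maxHeartbeats 400000 in
/-- **[Balaban1985RegularSpaces] (1.47) AT THE T³ CARRIER, QUANTIFIED**: if `U₁ = e^{iX}` satisfies (19) at radius `ε₂ ≤ ¼` relative to `U₀` (only the bond and
gradient members are used) and `|U₀(∂p) − 1| < a·η²`, then `|(U₁U₀)(∂p) − 1| < (2a + 11ε₂)·η²`.  Print: `(∂_{U₀}U₁)(p) − 1 = iη(D^η_{U₀}ηA)(p) + O₁(½η²(∂|A|(p))²)`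
and `(U₁U₀)(∂p) = (∂_{U₀}U₁)(p)·U₀(∂p)`; here the linear term is the difference of two (19)-gradient entries (`< 2ε₂η²`), the one-factor remainders
`e^{iX} − 1 − iX` give `≤ 2ε₂²η²`, the product remainder `≤ 32ε₂²η²`, the curvature × fluctuation term `≤ 4aε₂η³ ≤ aη²`.
[cite: Balaban1985RegularSpaces, (1.47) p.84; Balaban1985Variational, (19) p.281, (2) p.278] -/
theorem dist1_plaqHol_emb15_lt {ε₂ a : ℝ} (hε₂ : ε₂ ≤ 1 / 4) {U₀ U₁ : GaugeField (F.P K) 0 (Matrix.specialUnitaryGroup (Fin 2) ℂ)}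
    {X : PBond (F.P K) 0 → Matrix (Fin 2) (Fin 2) ℂ} (h19 : In19 F n K ε₂ U₀ U₁ X) (p : Plaq (F.P K) 0)
    (hp : dist1 (GaugeField.plaqHol U₀ p) < a * eta F n K ^ 2) :
    dist1 (GaugeField.plaqHol (emb15 U₀ U₁) p) < (2 * a + 11 * ε₂) * eta F n K ^ 2 := by
  set η : ℝ := eta F n K with hηdef
  have hη : 0 < η := eta_pos F n K
  have hη1 : η ≤ 1 := eta_le_one F n K
  have hε₂0 : 0 < ε₂ := by
    have hb := h19.2.2.1 ⟨default, ⟨0, (F.P K).hd⟩⟩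
    exact (mul_pos_iff_of_pos_right hη).mp ((norm_nonneg _).trans_lt hb)
  have ha : 0 < a := by
    have := (GaugeGroup.dist1_nonneg _).trans_lt hp
    exact (mul_pos_iff_of_pos_right (pow_pos hη 2)).mp this
  -- abbreviations (matrices)
  set b₁ : PBond (F.P K) 0 := ⟨p.src, p.μ⟩
  set b₂ : PBond (F.P K) 0 := ⟨p.src.shift p.μ, p.ν⟩
  set b₃ : PBond (F.P K) 0 := ⟨p.src.shift p.ν, p.μ⟩
  set b₄ : PBond (F.P K) 0 := ⟨p.src, p.ν⟩
  set u₁ : Matrix (Fin 2) (Fin 2) ℂ := ((U₀ b₁ : Matrix.specialUnitaryGroup (Fin 2) ℂ) : Matrix (Fin 2) (Fin 2) ℂ)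
  set u₄ : Matrix (Fin 2) (Fin 2) ℂ := ((U₀ b₄ : Matrix.specialUnitaryGroup (Fin 2) ℂ) : Matrix (Fin 2) (Fin 2) ℂ)
  set Y : PBond (F.P K) 0 → Matrix (Fin 2) (Fin 2) ℂ := fun b => ((U₁ b : Matrix.specialUnitaryGroup (Fin 2) ℂ) : Matrix (Fin 2) (Fin 2) ℂ) - 1 with hYdef
  set P : Matrix (Fin 2) (Fin 2) ℂ := ((GaugeField.plaqHol (emb15 U₀ U₁) p : Matrix.specialUnitaryGroup (Fin 2) ℂ) : Matrix (Fin 2) (Fin 2) ℂ)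
  set P₀ : Matrix (Fin 2) (Fin 2) ℂ := ((GaugeField.plaqHol U₀ p : Matrix.specialUnitaryGroup (Fin 2) ℂ) : Matrix (Fin 2) (Fin 2) ℂ)
  -- bond sizes from (19)
  have hYX : ∀ b, ‖Y b‖ ≤ ‖X b‖ := fun b => by
    simp only [hYdef, h19.2.1 b]; exact norm_exp_I_smul_sub_one_le' (h19.1 b).1
  have hXb : ∀ b, ‖X b‖ < ε₂ * η := h19.2.2.1
  have hYb : ∀ b, ‖Y b‖ < ε₂ * η := fun b => (hYX b).trans_lt (hXb b)
  have hsmall : ε₂ * η ≤ 1 / 4 := by nlinarith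
  have hY1 : ∀ b, ‖Y b‖ ≤ 1 := fun b => by linarith [hYb b]
  have hRb : ∀ b, ‖Y b - Complex.I • X b‖ ≤ (ε₂ * η) ^ 2 / 2 := fun b => by
    have h1 : ‖Y b - Complex.I • X b‖ ≤ ‖X b‖ ^ 2 / 2 := by
      simp only [hYdef, h19.2.1 b]; exact norm_exp_I_smul_sub_one_sub_le_sq (h19.1 b).1
    have h2 : ‖X b‖ ^ 2 ≤ (ε₂ * η) ^ 2 := pow_le_pow_left₀ (norm_nonneg _) (hXb b).le 2
    linarith
  -- the expansion at the background (p1 lineage), fluctuation = U₁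
  have eW := coe_emb15_mul_star U₀ U₁
  have key := norm_plaqHol_mul_star_bg_sub_one_sub_covCurl_le (emb15 U₀ U₁) U₀ p (by rw [eW]; exact hY1 _) (by rw [eW]; exact hY1 _)
  simp only [eW] at key
  -- `key : ‖P * star P₀ - 1 - LIN‖ ≤ 2 (ΣY)^2 + 2 ‖P₀ - 1‖ (‖Y b₃‖ + ‖Y b₄‖)` with LIN = Y b₁ + u₁ Y b₂ u₁^* - u₄ Y b₃ u₄^* - Y b₄
  -- the linear term in `X`: a difference of two (19)-gradient entries
  have hG1 := h19.2.2.2.1 p.μ p.ν p.src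
  have hG2 := h19.2.2.2.1 p.ν p.μ p.src
  rw [covGradT_one_bgUnits_eq] at hG1 hG2
  have hLX : ‖Complex.I • X b₁ + u₁ * (Complex.I • X b₂) * star u₁ - u₄ * (Complex.I • X b₃) * star u₄ - Complex.I • X b₄‖ < 2 * ε₂ * η ^ 2 := by
    have e : Complex.I • X b₁ + u₁ * (Complex.I • X b₂) * star u₁ - u₄ * (Complex.I • X b₃) * star u₄ - Complex.I • X b₄
        = Complex.I • ((u₁ * X b₂ * star u₁ - X b₄) - (u₄ * X b₃ * star u₄ - X b₁)) := by
      simp only [smul_sub, mul_smul_comm, smul_mul_assoc]; abel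
    rw [e, norm_smul, Complex.norm_I, one_mul]
    exact (norm_sub_le _ _).trans_lt (by linarith)
  -- the one-factor remainders
  have hD : ‖(Y b₁ + u₁ * Y b₂ * star u₁ - u₄ * Y b₃ * star u₄ - Y b₄)
      - (Complex.I • X b₁ + u₁ * (Complex.I • X b₂) * star u₁ - u₄ * (Complex.I • X b₃) * star u₄ - Complex.I • X b₄)‖ ≤ 2 * (ε₂ * η) ^ 2 := by
    have e : (Y b₁ + u₁ * Y b₂ * star u₁ - u₄ * Y b₃ * star u₄ - Y b₄)
        - (Complex.I • X b₁ + u₁ * (Complex.I • X b₂) * star u₁ - u₄ * (Complex.I • X b₃) * star u₄ - Complex.I • X b₄)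
        = (Y b₁ - Complex.I • X b₁) + u₁ * (Y b₂ - Complex.I • X b₂) * star u₁ - u₄ * (Y b₃ - Complex.I • X b₃) * star u₄ - (Y b₄ - Complex.I • X b₄) := by
      simp only [mul_sub, sub_mul]; abel
    rw [e]
    have hu₁ : u₁ ∈ unitary (Matrix (Fin 2) (Fin 2) ℂ) := (U₀ b₁).2.1
    have hu₄ : u₄ ∈ unitary (Matrix (Fin 2) (Fin 2) ℂ) := (U₀ b₄).2.1
    have n2 : ‖u₁ * (Y b₂ - Complex.I • X b₂) * star u₁‖ = ‖Y b₂ - Complex.I • X b₂‖ := by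
      rw [CStarRing.norm_mul_mem_unitary _ (Unitary.star_mem hu₁), CStarRing.norm_mem_unitary_mul _ hu₁]
    have n3 : ‖u₄ * (Y b₃ - Complex.I • X b₃) * star u₄‖ = ‖Y b₃ - Complex.I • X b₃‖ := by
      rw [CStarRing.norm_mul_mem_unitary _ (Unitary.star_mem hu₄), CStarRing.norm_mem_unitary_mul _ hu₄]
    calc _ ≤ ‖Y b₁ - Complex.I • X b₁‖ + ‖u₁ * (Y b₂ - Complex.I • X b₂) * star u₁‖ + ‖u₄ * (Y b₃ - Complex.I • X b₃) * star u₄‖ + ‖Y b₄ - Complex.I • X b₄‖ := by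
          refine (norm_sub_le _ _).trans ?_
          refine add_le_add ((norm_sub_le _ _).trans (add_le_add ((norm_add_le _ _).trans le_rfl) le_rfl)) le_rfl
      _ ≤ (ε₂ * η) ^ 2 / 2 + (ε₂ * η) ^ 2 / 2 + (ε₂ * η) ^ 2 / 2 + (ε₂ * η) ^ 2 / 2 := by
          rw [n2, n3]; exact add_le_add (add_le_add (add_le_add (hRb _) (hRb _)) (hRb _)) (hRb _)
      _ = 2 * (ε₂ * η) ^ 2 := by ring
  -- the linear term in `Y`
  have hLY : ‖Y b₁ + u₁ * Y b₂ * star u₁ - u₄ * Y b₃ * star u₄ - Y b₄‖ < 2 * ε₂ * η ^ 2 + 2 * (ε₂ * η) ^ 2 := by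
    have := norm_sub_le_norm_sub_add_norm_sub (Y b₁ + u₁ * Y b₂ * star u₁ - u₄ * Y b₃ * star u₄ - Y b₄)
      (Complex.I • X b₁ + u₁ * (Complex.I • X b₂) * star u₁ - u₄ * (Complex.I • X b₃) * star u₄ - Complex.I • X b₄) 0
    rw [sub_zero, sub_zero] at this
    linarith
  -- the background plaquette
  have hP₀ : ‖P₀ - 1‖ < a * η ^ 2 := hp
  -- assemble `‖P·P₀^* − 1‖`
  have hQ : ‖P * star P₀ - 1‖ < 2 * ε₂ * η ^ 2 + 2 * (ε₂ * η) ^ 2 + 2 * (4 * (ε₂ * η)) ^ 2 + 2 * (a * η ^ 2) * (2 * (ε₂ * η)) := by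
    have hsum : ‖Y b₁‖ + ‖Y b₂‖ + ‖Y b₃‖ + ‖Y b₄‖ < 4 * (ε₂ * η) := by linarith [hYb b₁, hYb b₂, hYb b₃, hYb b₄]
    have hsum0 : 0 ≤ ‖Y b₁‖ + ‖Y b₂‖ + ‖Y b₃‖ + ‖Y b₄‖ := by positivity
    have hsq : (‖Y b₁‖ + ‖Y b₂‖ + ‖Y b₃‖ + ‖Y b₄‖) ^ 2 ≤ (4 * (ε₂ * η)) ^ 2 := pow_le_pow_left₀ hsum0 hsum.le 2
    have h34 : ‖Y b₃‖ + ‖Y b₄‖ ≤ 2 * (ε₂ * η) := by linarith [hYb b₃, hYb b₄]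
    have hcurv : 2 * ‖P₀ - 1‖ * (‖Y b₃‖ + ‖Y b₄‖) ≤ 2 * (a * η ^ 2) * (2 * (ε₂ * η)) := by
      have h1 : 0 ≤ ‖P₀ - 1‖ := norm_nonneg _
      have h2 : 0 ≤ ‖Y b₃‖ + ‖Y b₄‖ := by positivity
      nlinarith
    have htri : ‖P * star P₀ - 1‖ ≤ ‖Y b₁ + u₁ * Y b₂ * star u₁ - u₄ * Y b₃ * star u₄ - Y b₄‖
        + ‖P * star P₀ - 1 - (Y b₁ + u₁ * Y b₂ * star u₁ - u₄ * Y b₃ * star u₄ - Y b₄)‖ := by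
      have := norm_add_le (Y b₁ + u₁ * Y b₂ * star u₁ - u₄ * Y b₃ * star u₄ - Y b₄)
        (P * star P₀ - 1 - (Y b₁ + u₁ * Y b₂ * star u₁ - u₄ * Y b₃ * star u₄ - Y b₄))
      rwa [add_sub_cancel] at this
    linarith
  -- back to `‖P − 1‖`: `P − 1 = (P·P₀^* − 1)·P₀ + (P₀ − 1)`
  have hP₀u : P₀ ∈ unitary (Matrix (Fin 2) (Fin 2) ℂ) := (GaugeField.plaqHol U₀ p).2.1
  have eP : P - 1 = (P * star P₀ - 1) * P₀ + (P₀ - 1) := by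
    have h := Unitary.star_mul_self_of_mem hP₀u
    calc P - 1 = P * (star P₀ * P₀) - 1 := by rw [h, mul_one]
      _ = (P * star P₀ - 1) * P₀ + (P₀ - 1) := by noncomm_ring
  have hfin : ‖P - 1‖ ≤ ‖P * star P₀ - 1‖ + ‖P₀ - 1‖ := by
    rw [eP]
    refine (norm_add_le _ _).trans (add_le_add (le_of_eq ?_) le_rfl)
    exact CStarRing.norm_mul_mem_unitary _ hP₀u
  show ‖P - 1‖ < (2 * a + 11 * ε₂) * η ^ 2
  have hnum : 2 * ε₂ * η ^ 2 + 2 * (ε₂ * η) ^ 2 + 2 * (4 * (ε₂ * η)) ^ 2 + 2 * (a * η ^ 2) * (2 * (ε₂ * η)) + a * η ^ 2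
      ≤ (2 * a + 11 * ε₂) * η ^ 2 := by
    have h1 : (ε₂ * η) ^ 2 ≤ ε₂ * η ^ 2 / 4 := by nlinarith
    have h2 : 2 * (a * η ^ 2) * (2 * (ε₂ * η)) ≤ a * η ^ 2 := by
      have : 4 * (ε₂ * η) ≤ 1 := by linarith
      have h0 : 0 ≤ a * η ^ 2 := by positivity
      nlinarith
    nlinarith
  linarith

/-! ## §3 Row (D)'s plaquette clause: `PlaqSmall` for `U₁U₀` and for its gauge images -/

variable {F n K}

/-- **THE PLAQUETTE CLAUSE OF ROW (D) AT THE T³ CARRIER**: `U₀` plaquette-regular at radius `a` (print's (2), first clause, `regThreshold F n K a = a·L^{−2(K−n)}`)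
and `U₁` in (19) at `ε₂ ≤ ¼` relative to `U₀` ⟹ `U₁U₀` plaquette-regular at radius `2a + 11ε₂`.
[cite: Balaban1985RegularSpaces, (1.47) p.84, Prop. 7 p.98; Balaban1985Variational, (2) p.278, (19) p.281, p.299] -/
theorem plaqSmall_emb15_of_in19 {ε₂ a : ℝ} (hε₂ : ε₂ ≤ 1 / 4) {U₀ U₁ : GaugeField (F.P K) 0 (Matrix.specialUnitaryGroup (Fin 2) ℂ)}
    {X : PBond (F.P K) 0 → Matrix (Fin 2) (Fin 2) ℂ} (hU₀ : PlaqSmall (regThreshold F n K a) U₀) (h19 : In19 F n K ε₂ U₀ U₁ X) :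
    PlaqSmall (regThreshold F n K (2 * a + 11 * ε₂)) (emb15 U₀ U₁) := by
  intro p
  have e : ∀ c : ℝ, regThreshold F n K c = c * eta F n K ^ 2 := fun c => by
    rw [eta_pow]; rfl
  rw [e]
  exact dist1_plaqHol_emb15_lt F n K hε₂ h19 p (by rw [← e]; exact hU₀ p)

/-- The same for every gauge image `(U₁U₀)^u` (plaquette regularity is gauge invariant, `T3PrintedRegularOrbits.plaqSmall_gaugeAct_iff'`) — the form row (D)
consumes, `u` being the (1.29)-restricted transformation of seat w1's `CritL`. [cite: Balaban1985Variational, p.299 (before (141)), (4) p.278] -/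
theorem plaqSmall_gaugeAct_emb15_of_in19 {ε₂ a : ℝ} (hε₂ : ε₂ ≤ 1 / 4) {U₀ U₁ : GaugeField (F.P K) 0 (Matrix.specialUnitaryGroup (Fin 2) ℂ)}
    {X : PBond (F.P K) 0 → Matrix (Fin 2) (Fin 2) ℂ} (hU₀ : PlaqSmall (regThreshold F n K a) U₀) (h19 : In19 F n K ε₂ U₀ U₁ X)
    (u : GaugeTransf (F.P K) 0 (Matrix.specialUnitaryGroup (Fin 2) ℂ)) :
    PlaqSmall (regThreshold F n K (2 * a + 11 * ε₂)) (GaugeField.gaugeAct u (emb15 U₀ U₁)) :=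
  (T3PrintedRegularOrbits.plaqSmall_gaugeAct_iff' _ u _).mpr (plaqSmall_emb15_of_in19 hε₂ hU₀ h19)

end Plaquette

end Summit.QuantumFields.YangMills.Theorems.Prop7B8Prop7Plaq

end
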